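import Summits.CriticalPhenomena.CardyFormulaZ2.Theses.ModulusResponse

/-!
# Assembly of route `ModulusResponse` (sub-problem `CardyFormulaZ2`)

Item `stmt-CriticalPhenomena-6474`: the assembly statement
`SmirnovResponse → SegmentRSW → SmirnovCellAnchor → SegmentTransport → BondIdentification →
SquarePinning → CardyFormulaZ2` of the route `route-CriticalPhenomena-ModulusResponse`.
It is pure logic plus one rewrite, exactly the body of the route's deciding theorem
`ModulusResponse.closes`: `SquarePinning` reduces `CardyFormulaZ2` to linear-image Cardy for the
pinned diagonal stretches `S_t z = cosh t · z + i sinh t · z̄`; for the cell family `μ` pinned by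
its defining push-forward term (hypothesis discharged by `rfl`), `SegmentTransport` at
`u = 1/2 ∈ [0, 1/2]` — fed by `SegmentRSW` (uniform box crossings), the anchor
`⟨t₀ = -(log 3)/4, SmirnovCellAnchor⟩` and `SmirnovResponse` (first-order response at `u = 0`) —
gives one `t` with `μ (1/2)`-crossing limits `F(η(R))` for every conformal rectangle `R`, and
`BondIdentification` rewrites `μ (1/2)` into `bondPercolation (zdGraph 2) half`, after which the
conclusion is literally the antecedent of `SquarePinning` (`discreteCrossingProb` unfolds by `rfl`).

No mathematics beyond modus ponens lives here; the content of the route is in its cruxes.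
-/

namespace Summit.CriticalPhenomena.CardyFormulaZ2.Theorems

open Summit.CriticalPhenomena.CardyFormulaZ2.Theses

/-- **Assembly of the `ModulusResponse` route** (item `stmt-CriticalPhenomena-6474`):
the six route hypotheses `SmirnovResponse`, `SegmentRSW`, `SmirnovCellAnchor`, `SegmentTransport`,
`BondIdentification`, `SquarePinning` imply `CardyFormulaZ2`. Proof: apply `SquarePinning`;
for the given pinned stretches `S` instantiate the pinned cell family `μ` by its defining term,
apply `SegmentTransport μ S` at `u = 1/2` with the inputs `SegmentRSW μ`,
`⟨-(log 3)/4, SmirnovCellAnchor μ S⟩`, `SmirnovResponse μ S`, and rewrite `μ (1/2)` by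
`BondIdentification` (the same term as the route's deciding theorem `ModulusResponse.closes`). -/
theorem modulusResponse_assembly_proof : ModulusResponse.Assembly := by
  unfold ModulusResponse.Assembly
  intro hResp hRSW hAnchor hTrans hBond hPin
  apply hPin
  intro S hS
  suffices h : ∀ μ : ℝ → MeasureTheory.Measure
      (Literature.Probability.Percolation.BondConfig (Literature.Probability.LatticeModels.Site 2)),
      (∀ u, μ u = MeasureTheory.Measure.map
        (fun p : Set (Literature.Probability.LatticeModels.Site 2) ×
            Set (Literature.Probability.LatticeModels.Site 2) ↦
          {e | ∃ m, (m ∈ p.1 ∧ e = s(m - Pi.single 0 1, m)) ∨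
            ((m ∈ p.1 ↔ m ∉ p.2) ∧ e = s(m - Pi.single 1 1, m))})
        ((ProbabilityTheory.setBernoulli Set.univ Literature.Probability.Percolation.half).prod
          (ProbabilityTheory.setBernoulli Set.univ (Set.projIcc 0 1 zero_le_one u)))) →
      ∃ t : ℝ, ∀ R : Literature.Probability.RandomPlanarGeometry.ConformalRectangle,
        R.HasCrossingLimit (fun δ ↦ Literature.Probability.Percolation.discreteCrossingProb
          Literature.Probability.Percolation.half (S t '' R.carrier) δ (S t '' R.arc 0)
          (S t '' R.arc 2))
          Literature.Probability.RandomPlanarGeometry.cardyFunction from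
    h _ (fun _ ↦ rfl)
  intro μ hμ
  have hmem : (1 / 2 : ℝ) ∈ Set.Icc (0 : ℝ) (1 / 2) := ⟨by norm_num, le_rfl⟩
  obtain ⟨t, ht⟩ := hTrans μ S hμ hS (hRSW μ hμ) ⟨-(Real.log 3) / 4, hAnchor μ S hμ hS⟩
    (hResp μ S hμ hS) (1 / 2) hmem
  refine ⟨t, fun R ↦ ?_⟩
  have hR := ht R
  rw [hBond μ hμ] at hR
  exact hR

end Summit.CriticalPhenomena.CardyFormulaZ2.Theorems
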